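import Mathlib
import Summits.ValiantsHypothesis.ValiantsHypothesis.Theorems.DivisionGapPerMultiplesHardStubTypedDecomposition
import Summits.ValiantsHypothesis.ValiantsHypothesis.Theorems.DivisionGapPerMultiplesHardStubAlignedRigidity
import Literature.Computability.AlgebraicComplexity.ArithCircuitProofs
import Literature.Computability.AlgebraicComplexity.PermanentIrreducible

/-!
# The typed vertex count (line `uncharged-face-walk` of crux `PerMultiplesHard`, route DivisionGap)

The second jaw of the line, now a theorem: for `n ≥ 3` and a TORUS-HOMOGENEOUS `g ∈ ℝ≥0[x_ij]`
(all monomials are `n × n` exponent tables with the same row margins `R` and column margins `C`)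
all of whose rows are hit, the number of PURE monomials of `g` (those supported inside the graph
`{(π j, j)}` of some permutation `π`) is at most
`L⁺(g) · ⌊2n/3⌋!·(n-⌊2n/3⌋)! · max_π #Pure_π(g)` (`thinPatterns`).  It is the composition of the
two landed stubs `stub_typedDecomposition` (row-support-balanced typed decomposition) and
`stub_alignedRigidity` (a balanced typed factor serves at most `⌊2n/3⌋!(n-⌊2n/3⌋)!` permutations)
through the counting lemma `card_pure_le_of_decomposition` (adapted from the sibling skeleton
`Cruxes/PerDivisionHard/Lines/typed-vertex-rectangles.lean`, sorry-free there).

Corollary (the POWERS rung, new as a theorem): `n! ≤ L⁺(per_n^M) · ⌊2n/3⌋!(n-⌊2n/3⌋)!`, i.e.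
`C(n, n-⌊2n/3⌋) ≤ L⁺(per_n^M)` for every `M ≥ 1`, `n ≥ 3` (`choose_le_complexity_perPoly_pow`):
the monotone complexity of every power of the permanent is exponential, whatever the power.  In
print only the Boolean transfer `n^{Ω(log n)}` (Razborov 1985; HrubesYehudayoff2021 Rem. 45–46) was
available for `per^M`, `M ≥ 2`.

Not here: the line's open core `stub_residual` (aligned, pure-poor cofactors).
-/

noncomputable section

namespace Summit.ValiantsHypothesis.ValiantsHypothesis.Theorems.DivisionGap.PerMultiplesHard.ThinPatterns

open MvPolynomial Literature.Computability.AlgebraicComplexity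
open scoped NNReal BigOperators

/-- A monomial of `a · b` supported inside a perfect matching splits as `B + B'` with `B ∈ supp a`
supported inside the same matching. [folklore] -/
theorem exists_aligned_part {n : ℕ} {a b : MvPolynomial (Fin n × Fin n) ℝ≥0}
    {m : (Fin n × Fin n) →₀ ℕ} (hm : m ∈ (a * b).support) (π : Equiv.Perm (Fin n))
    (hπ : ∀ e ∈ m.support, e.1 = π e.2) :
    ∃ B ∈ a.support, ∀ e ∈ B.support, e.1 = π e.2 := by
  classical
  have hmul := MvPolynomial.support_mul a b hm
  obtain ⟨B, hB, B', -, hBB'⟩ := Finset.mem_add.mp hmul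
  refine ⟨B, hB, fun e he => hπ e ?_⟩
  rw [Finsupp.mem_support_iff] at he ⊢
  rw [← hBB', Finsupp.add_apply]
  omega

/-- **The counting lemma** (adapted from the sibling skeleton
`Cruxes/PerDivisionHard/Lines/typed-vertex-rectangles.lean`).  If `g = Σ_{t<s} a_t · b_t` and every
`a_t` serves at most `K` permutations `π` (some monomial of `a_t` is supported inside `{(π j, j)}`),
then `#Pure(g) ≤ s · K · max_π #Pure_π(g)`.  Only `supp (Σ) ⊆ ⋃ supp`, `supp (a·b) ⊆ supp a + supp b`
and `B ≤ B + B'` are used. [folklore] -/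
theorem card_pure_le_of_decomposition {n s : ℕ} (g : MvPolynomial (Fin n × Fin n) ℝ≥0)
    (a b : Fin s → MvPolynomial (Fin n × Fin n) ℝ≥0) (hg : g = ∑ t, a t * b t) (K : ℕ)
    (hK : ∀ t, (Finset.univ.filter fun π : Equiv.Perm (Fin n) =>
        ∃ B ∈ (a t).support, ∀ e ∈ B.support, e.1 = π e.2).card ≤ K) :
    ((g.support.filter fun m => ∃ σ : Equiv.Perm (Fin n), ∀ e ∈ m.support, e.1 = σ e.2).card) ≤
      s * K * Finset.univ.sup (fun π : Equiv.Perm (Fin n) =>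
        (g.support.filter fun m => ∀ e ∈ m.support, e.1 = π e.2).card) := by
  classical
  let F : Equiv.Perm (Fin n) → ℕ := fun π =>
    (g.support.filter fun m => ∀ e ∈ m.support, e.1 = π e.2).card
  let M : ℕ := Finset.univ.sup F
  let Pure : Finset ((Fin n × Fin n) →₀ ℕ) :=
    g.support.filter fun m => ∃ σ : Equiv.Perm (Fin n), ∀ e ∈ m.support, e.1 = σ e.2
  have hFM : ∀ π, F π ≤ M := fun π => Finset.le_sup (f := F) (Finset.mem_univ π)
  have h1 : Pure ⊆ Finset.univ.biUnion fun t => Pure.filter fun m => m ∈ (a t * b t).support := by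
    intro m hm
    have hmg : m ∈ g.support := (Finset.mem_filter.mp hm).1
    rw [hg] at hmg
    obtain ⟨t, -, ht⟩ := Finset.mem_biUnion.mp (MvPolynomial.support_sum hmg)
    exact Finset.mem_biUnion.mpr ⟨t, Finset.mem_univ t, Finset.mem_filter.mpr ⟨hm, ht⟩⟩
  have h2 : ∀ t, (Pure.filter fun m => m ∈ (a t * b t).support).card ≤ K * M := by
    intro t
    let Adm : Finset (Equiv.Perm (Fin n)) :=
      Finset.univ.filter fun π : Equiv.Perm (Fin n) =>
        ∃ B ∈ (a t).support, ∀ e ∈ B.support, e.1 = π e.2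
    have hsub : (Pure.filter fun m => m ∈ (a t * b t).support) ⊆
        Adm.biUnion fun π => g.support.filter fun m => ∀ e ∈ m.support, e.1 = π e.2 := by
      intro m hm
      obtain ⟨hmP, hmab⟩ := Finset.mem_filter.mp hm
      obtain ⟨hmg, σ, hσ⟩ := Finset.mem_filter.mp hmP
      obtain ⟨B, hB, hBσ⟩ := exists_aligned_part hmab σ hσ
      exact Finset.mem_biUnion.mpr ⟨σ, Finset.mem_filter.mpr ⟨Finset.mem_univ σ, B, hB, hBσ⟩,
        Finset.mem_filter.mpr ⟨hmg, hσ⟩⟩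
    calc (Pure.filter fun m => m ∈ (a t * b t).support).card
        ≤ (Adm.biUnion fun π => g.support.filter fun m => ∀ e ∈ m.support, e.1 = π e.2).card :=
          Finset.card_le_card hsub
      _ ≤ ∑ π ∈ Adm, F π := Finset.card_biUnion_le
      _ ≤ ∑ π ∈ Adm, M := Finset.sum_le_sum fun π _ => hFM π
      _ = Adm.card * M := by rw [Finset.sum_const, smul_eq_mul]
      _ ≤ K * M := Nat.mul_le_mul_right M (hK t)
  calc Pure.card
      ≤ (Finset.univ.biUnion fun t => Pure.filter fun m => m ∈ (a t * b t).support).card :=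
        Finset.card_le_card h1
    _ ≤ ∑ t, (Pure.filter fun m => m ∈ (a t * b t).support).card := Finset.card_biUnion_le
    _ ≤ ∑ _t : Fin s, K * M := Finset.sum_le_sum fun t _ => h2 t
    _ = s * (K * M) := by rw [Finset.sum_const, Finset.card_univ, Fintype.card_fin, smul_eq_mul]
    _ = s * K * M := (Nat.mul_assoc s K M).symm

/-- **The typed vertex count (`thinPatterns`, the skeleton's second jaw).**  For `n ≥ 3` and a
torus-homogeneous `g` (margins `R`, `C`) all of whose rows are hit (`R i ≠ 0`):
`#Pure(g) ≤ L⁺(g) · ⌊2n/3⌋!(n-⌊2n/3⌋)! · max_π #Pure_π(g)`.  Proof: `stub_typedDecomposition` writes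
`g = Σ_{t<s} a_t b_t`, `s ≤ L⁺(g)`, with every `a_t` typed of balanced row support;
`stub_alignedRigidity` bounds the permutations served by each `a_t`; `card_pure_le_of_decomposition`
counts. [folklore] -/
theorem thinPatterns :
    ∀ n ≥ 3, ∀ (g : MvPolynomial (Fin n × Fin n) ℝ≥0) (R C : Fin n → ℕ),
      (∀ m ∈ g.support, (∀ i, ∑ j, m (i, j) = R i) ∧ (∀ j, ∑ i, m (i, j) = C j)) →
      (∀ i, R i ≠ 0) →
      (g.support.filter fun m => ∃ σ : Equiv.Perm (Fin n), ∀ e ∈ m.support, e.1 = σ e.2).card ≤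
        complexity g * ((2 * n / 3).factorial * (n - 2 * n / 3).factorial) *
          Finset.univ.sup (fun π : Equiv.Perm (Fin n) =>
            (g.support.filter fun m => ∀ e ∈ m.support, e.1 = π e.2).card) := by
  classical
  intro n hn g R C hg hR
  obtain ⟨s, hs, a, b, hgab, htyp⟩ :=
    TypedDecomposition.stub_typedDecomposition n hn g R C hg hR
  have hK : ∀ t, (Finset.univ.filter fun π : Equiv.Perm (Fin n) =>
      ∃ B ∈ (a t).support, ∀ e ∈ B.support, e.1 = π e.2).card ≤
        (2 * n / 3).factorial * (n - 2 * n / 3).factorial := by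
    intro t
    obtain ⟨ρ, γ, hty, hlo, hhi⟩ := htyp t
    exact AlignedRigidity.stub_alignedRigidity n (a t) ρ γ hty hlo hhi
  have hcount := card_pure_le_of_decomposition g a b hgab _ hK
  calc (g.support.filter fun m => ∃ σ : Equiv.Perm (Fin n), ∀ e ∈ m.support, e.1 = σ e.2).card
      ≤ s * ((2 * n / 3).factorial * (n - 2 * n / 3).factorial) *
          Finset.univ.sup (fun π : Equiv.Perm (Fin n) =>
            (g.support.filter fun m => ∀ e ∈ m.support, e.1 = π e.2).card) := hcount
    _ ≤ complexity g * ((2 * n / 3).factorial * (n - 2 * n / 3).factorial) *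
          Finset.univ.sup (fun π : Equiv.Perm (Fin n) =>
            (g.support.filter fun m => ∀ e ∈ m.support, e.1 = π e.2).card) :=
        Nat.mul_le_mul_right _ (Nat.mul_le_mul_right _ hs)

/-! ## Corollary: the powers rung `C(n, n-⌊2n/3⌋) ≤ L⁺(per_n^M)` for every `M ≥ 1` -/

/-- Over `ℝ≥0` the sum of a monomial of `f` and a monomial of `g` is a monomial of `f * g`
(no cancellation). [folklore] -/
theorem add_mem_support_mul {n : ℕ} {f g : MvPolynomial (Fin n × Fin n) ℝ≥0}
    {m m' : (Fin n × Fin n) →₀ ℕ} (hm : m ∈ f.support) (hm' : m' ∈ g.support) :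
    m + m' ∈ (f * g).support := by
  classical
  rw [mem_support_iff] at hm hm' ⊢
  rw [coeff_mul]
  intro h
  have h0 := (Finset.sum_eq_zero_iff.1 h) (m, m') (Finset.HasAntidiagonal.mem_antidiagonal.2 rfl)
  rcases mul_eq_zero.1 h0 with h1 | h1
  · exact hm h1
  · exact hm' h1

/-- `per_n · h` is torus-homogeneous with margins `(r + 1, cc + 1)` when `h` has margins `(r, cc)`
(every monomial of `per · h` is `μ_σ + A`, `A ∈ supp h`). [folklore] -/
theorem margins_perPoly_mul {n : ℕ} {h : MvPolynomial (Fin n × Fin n) ℝ≥0} {r cc : Fin n → ℕ}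
    (hh : ∀ m ∈ h.support, (∀ i, ∑ j, m (i, j) = r i) ∧ (∀ j, ∑ i, m (i, j) = cc j)) :
    ∀ m ∈ (perPoly (Fin n) ℝ≥0 * h).support,
      (∀ i, ∑ j, m (i, j) = r i + 1) ∧ (∀ j, ∑ i, m (i, j) = cc j + 1) := by
  classical
  intro m hm
  obtain ⟨u, hu, A, hA, rfl⟩ := Finset.mem_add.mp (MvPolynomial.support_mul _ _ hm)
  obtain ⟨σ, rfl⟩ :=
    exists_permMonomial_eq_of_coeff_perPoly_ne_zero ℝ≥0 (MvPolynomial.mem_support_iff.mp hu)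
  obtain ⟨hr, hc⟩ := hh A hA
  refine ⟨fun i => ?_, fun j => ?_⟩
  · have h1 : ∑ j, permMonomial σ (i, j) = 1 := rowCount_permMonomial σ i
    have h2 := hr i
    simp only [Finsupp.coe_add, Pi.add_apply, Finset.sum_add_distrib, h1, h2]
    omega
  · have h1 : ∑ i, permMonomial σ (i, j) = 1 := colCount_permMonomial σ j
    have h2 := hc j
    simp only [Finsupp.coe_add, Pi.add_apply, Finset.sum_add_distrib, h1, h2]
    omega

/-- The margins of `per_n^k` are `(k, k)`. [folklore] -/
theorem margins_perPoly_pow {n : ℕ} (k : ℕ) :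
    ∀ m ∈ ((perPoly (Fin n) ℝ≥0) ^ k).support,
      (∀ i, ∑ j, m (i, j) = k) ∧ (∀ j, ∑ i, m (i, j) = k) := by
  classical
  induction k with
  | zero =>
    intro m hm
    rw [pow_zero, MvPolynomial.support_one] at hm
    rw [Finset.mem_singleton.mp hm]
    simp
  | succ k ih =>
    intro m hm
    rw [pow_succ'] at hm
    have h := margins_perPoly_mul (r := fun _ => k) (cc := fun _ => k) ih m hm
    exact ⟨fun i => h.1 i, fun j => h.2 j⟩

/-- The vertex monomials `k • μ_σ` lie in the support of `per_n^k`. [folklore] -/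
theorem smul_permMonomial_mem_support_pow {n : ℕ} (k : ℕ) (σ : Equiv.Perm (Fin n)) :
    k • permMonomial σ ∈ ((perPoly (Fin n) ℝ≥0) ^ k).support := by
  classical
  induction k with
  | zero =>
    rw [pow_zero, MvPolynomial.support_one, zero_smul]
    exact Finset.mem_singleton_self 0
  | succ k ih =>
    rw [pow_succ', succ_nsmul']
    refine add_mem_support_mul ?_ ih
    rw [mem_support_iff, coeff_permMonomial_perPoly]
    exact one_ne_zero

/-- A monomial with all column sums `M` supported inside the matching of `π` is `M • μ_π`, read
cellwise. [folklore] -/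
theorem apply_eq_of_aligned {n M : ℕ} {π : Equiv.Perm (Fin n)} {m : (Fin n × Fin n) →₀ ℕ}
    (hcol : ∀ j, ∑ i, m (i, j) = M) (hal : ∀ e ∈ m.support, e.1 = π e.2) (i j : Fin n) :
    m (i, j) = if i = π j then M else 0 := by
  classical
  have hzero : ∀ i', i' ≠ π j → m (i', j) = 0 := by
    intro i' hi'
    by_contra hne
    exact hi' (hal (i', j) (Finsupp.mem_support_iff.mpr hne))
  split_ifs with h
  · have hj := hcol j
    rw [Finset.sum_eq_single (π j)] at hj
    · rw [h]; exact hj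
    · intro i' _ hi'; exact hzero i' hi'
    · intro habs; exact absurd (Finset.mem_univ _) habs
  · exact hzero i h

/-- **The powers rung.**  `n! ≤ L⁺(per_n^M) · ⌊2n/3⌋!(n-⌊2n/3⌋)!` for all `n ≥ 3`, `M ≥ 1`: the
`n!` vertex monomials `M • μ_σ` of `per^M` are pure and pairwise distinct, at most one lies inside
each perfect matching, and `thinPatterns` applies to the torus-homogeneous full-row target `per^M`.
[folklore] -/
theorem factorial_le_complexity_perPoly_pow_mul (n M : ℕ) (hn : 3 ≤ n) (hM : 1 ≤ M) :
    n.factorial ≤ complexity ((perPoly (Fin n) ℝ≥0) ^ M) *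
      ((2 * n / 3).factorial * (n - 2 * n / 3).factorial) := by
  classical
  have heng := thinPatterns n hn ((perPoly (Fin n) ℝ≥0) ^ M) (fun _ => M) (fun _ => M)
    (margins_perPoly_pow M) (fun _ => by omega)
  -- at most one monomial of `per^M` inside each perfect matching
  have hsup : (Finset.univ.sup fun π : Equiv.Perm (Fin n) =>
      (((perPoly (Fin n) ℝ≥0) ^ M).support.filter
        fun m => ∀ e ∈ m.support, e.1 = π e.2).card) ≤ 1 := by
    refine Finset.sup_le fun π _ => Finset.card_le_one.mpr ?_
    intro m hm m' hm'
    obtain ⟨hm, hal⟩ := Finset.mem_filter.mp hm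
    obtain ⟨hm', hal'⟩ := Finset.mem_filter.mp hm'
    have hc := (margins_perPoly_pow M m hm).2
    have hc' := (margins_perPoly_pow M m' hm').2
    ext ⟨i, j⟩
    rw [apply_eq_of_aligned hc hal i j, apply_eq_of_aligned hc' hal' i j]
  -- all `n!` vertex monomials are pure and distinct
  have hpure : n.factorial ≤ (((perPoly (Fin n) ℝ≥0) ^ M).support.filter
      fun m => ∃ σ : Equiv.Perm (Fin n), ∀ e ∈ m.support, e.1 = σ e.2).card := by
    have hinj : Function.Injective fun σ : Equiv.Perm (Fin n) => M • permMonomial σ := by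
      intro σ τ hστ
      apply permMonomial_injective
      ext e
      have he := DFunLike.congr_fun hστ e
      simp only [Finsupp.smul_apply, smul_eq_mul] at he
      exact Nat.eq_of_mul_eq_mul_left (by omega) he
    have hsub : (Finset.univ.image fun σ : Equiv.Perm (Fin n) => M • permMonomial σ) ⊆
        (((perPoly (Fin n) ℝ≥0) ^ M).support.filter
          fun m => ∃ σ : Equiv.Perm (Fin n), ∀ e ∈ m.support, e.1 = σ e.2) := by
      intro m hm
      obtain ⟨σ, -, rfl⟩ := Finset.mem_image.mp hm
      refine Finset.mem_filter.mpr ⟨smul_permMonomial_mem_support_pow M σ, σ, ?_⟩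
      intro e he
      rw [Finsupp.mem_support_iff, Finsupp.smul_apply, smul_eq_mul] at he
      have hμ : permMonomial σ (e.1, e.2) ≠ 0 := fun h0 => he (by rw [show e = (e.1, e.2) from rfl, h0, mul_zero])
      rw [permMonomial_apply] at hμ
      by_contra hne
      exact hμ (if_neg fun h' => hne h'.symm)
    calc n.factorial = (Finset.univ : Finset (Equiv.Perm (Fin n))).card := by
          rw [Finset.card_univ, Fintype.card_perm, Fintype.card_fin]
      _ = (Finset.univ.image fun σ : Equiv.Perm (Fin n) => M • permMonomial σ).card :=
          (Finset.card_image_of_injective _ hinj).symm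
      _ ≤ _ := Finset.card_le_card hsub
  calc n.factorial ≤ _ := hpure
    _ ≤ _ := heng
    _ ≤ complexity ((perPoly (Fin n) ℝ≥0) ^ M) *
        ((2 * n / 3).factorial * (n - 2 * n / 3).factorial) * 1 := Nat.mul_le_mul_left _ hsup
    _ = complexity ((perPoly (Fin n) ℝ≥0) ^ M) *
        ((2 * n / 3).factorial * (n - 2 * n / 3).factorial) := Nat.mul_one _

/-- **`C(n, n-⌊2n/3⌋) ≤ L⁺(per_n^M)`** for all `n ≥ 3`, `M ≥ 1` — every power of the permanent has
exponential monotone complexity (`C(n, ⌈n/3⌉)`-type bound, `≥ 2^{0.9 n}/poly`). [folklore] -/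
theorem choose_le_complexity_perPoly_pow (n M : ℕ) (hn : 3 ≤ n) (hM : 1 ≤ M) :
    Nat.choose n (n - 2 * n / 3) ≤ complexity ((perPoly (Fin n) ℝ≥0) ^ M) := by
  have h1 := factorial_le_complexity_perPoly_pow_mul n M hn hM
  have hKpos : 0 < (2 * n / 3).factorial * (n - 2 * n / 3).factorial :=
    Nat.mul_pos (Nat.factorial_pos _) (Nat.factorial_pos _)
  have h2 : Nat.choose n (n - 2 * n / 3) * ((2 * n / 3).factorial * (n - 2 * n / 3).factorial) =
      n.factorial := by
    have hle : 2 * n / 3 ≤ n := by omega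
    have h := Nat.choose_mul_factorial_mul_factorial (Nat.sub_le n (2 * n / 3))
    rw [Nat.sub_sub_self hle] at h
    calc Nat.choose n (n - 2 * n / 3) * ((2 * n / 3).factorial * (n - 2 * n / 3).factorial)
        = Nat.choose n (n - 2 * n / 3) * (n - 2 * n / 3).factorial * (2 * n / 3).factorial := by ring
      _ = n.factorial := h
  exact Nat.le_of_mul_le_mul_right (h2 ▸ h1) hKpos

end Summit.ValiantsHypothesis.ValiantsHypothesis.Theorems.DivisionGap.PerMultiplesHard.ThinPatterns

end
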